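import Literature.NumberTheory.EllipticCurves.ManinConstantModularDegree
import HarnessLib
import HarnessLib.Audit.Tags

/-!
# Sketch-imc-g23d — THE WILD RESIDUAL R1 OF C3 AT `27 ∥ N` AS ONE LOCAL SINGULARITY
# (imc g23, MEMO-imc §29.9; HOME/imc/kit-g23/PROOFS-g23.md §5.11)

TYPER NOTE (typer g19, T-imc-38).  SOURCE = HOME/imc/kit-g23/Sketch-imc-g23d.lean sha16 299a2e68f7b92c48 (118 l.; the version ref1 §R143 audited —
E-imc-185 SURVIVES; imc's T-imc-38 line named the earlier draft a9d674ef7e7c860c; farm rc 0 · 0 err · 0 warn per imc; BC7 1/1 CLEAN, record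
HOME/imc/kit-g23/g23d-bc7.raw.txt 7de9df7271370608), landed VERBATIM except this note and the dropped `import HarnessLib.Audit.CruxProbe` /
`#h21_crux_probe` line.  Namespace `…ManinAdditive.WildTwentySeven` as written; imports ONLY the Literature leaf `ManinConstantModularDegree` —
ROUTE-INDEPENDENT.  HONEST FRAMING (typer summary; details = imc's text below): LENS imc (integrality of Néron / Katz–Mazur lattices: the
Česnavičius–Neururer–Saha inequality in its one excluded case at `27 ∥ N`, localised by PROOFS-g23 §5.11 to ONE wild `ℤ/3`-quotient singularity
`𝔖₂₇`); STATUS: E-imc-185 `CNSBoundAtWildTwentySeven` CONJECTURAL (an obligation node; on paper implied by `p_g(𝔖₂₇) = 0`, which is OPEN —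
ref1 §R143 note: «equivalent to rationality of `𝔖₂₇`» in imc's docstring is ONE direction (implied by), non-blocking); PROVED bookkeeping
`padicVal_three_maninConstant_le_modularDegree_of_twentySeven` (printed fact ∧ E-185 ⟹ the `p = 3` inequality at every `27 ∥ N` level); NOT IN
PRINT: nearest print BY NAME = tree facts `cesnaviciusNeururerSaha_padicVal_maninConstant_le_modularDegree` / `cesnaviciusNeururerSaha_thm_1_2`
(ČNS Thm 1.2: the excluded clause carries `+1`), ČNS §1 (reduce-to-compute) «not one we know how to solve completely»; BC5 (imc):
HOME/MANIN-ADDITIVE-CREMONA-TIER-v1.tsv.gz — of the 4287 isogeny classes with `27 ∥ N < 5·10⁵` and every other prime `≡ 1 (mod 3)`, 4265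
certified optimal with `c = 1` (0 violations), 22 band classes (`N > 4·10⁵`) pending (imc ERRATUM 09:54Z wording); `3 ∣ deg φ` on 4264/4265, so the
inequality never decides `3 ∤ c` there — the Manin-side residual of C3 on R1 stays with E-161 / 29.M; REFUTER VERDICTS: ref1 §R143 (R-imc-73):
SURVIVES, PROOFS §5.11 (a)(b)(c) SOUND on paper, 29.P needs Lipman `R¹π_*ω = 0` for equality; ref2 placement (ČNS §5 / Raynaud 1991 Astérisque
196–197 = acq-14543 / Edixhoven) PENDING.  CHEAPEST FALSIFIER: an optimal curve on an R1 level with `3 ∣ c` and `3 ∤ deg φ` (none `< 5·10⁵`); a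
computation of `p_g(𝔖₂₇) > 0` would not falsify the row but remove its paper support (L-imc-g23-2).  WHY IT MATTERS: the residual stub of the C3
line `Lines/ghost_duality` (R1 ∪ R2) reads R1 ⟸ [`p_g(𝔖₂₇) = 0` ∧ U2]; crux idea `Ideas/tame-window-27.md` cites this node by name.
PARTITION ladder-adjacent · beyond-print theorem: NO · bears_on: stmt-BirchSwinnertonDyer-22968 (C3).  BSD is not proved by this; C2/C3 OPEN.

Česnavičius–Neururer–Saha (JEMS 2024, Thm. 1.2; tree fact
`cesnaviciusNeururerSaha_padicVal_maninConstant_le_modularDegree`, whose two printed exceptional clauses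
are HYPOTHESES of the tree rendering) prove `val_p(c_φ) ≤ val_p(deg φ)` except, at `p = 3`, when
`27 ∣ N` and NO prime `q ∣ N` has `q ≡ 2 (mod 3)`; "the only role of the rational singularity assumption
is to ensure that `Pic⁰_{X₀(N)/ℤ}` is the Néron model" and "we do not know any `N` for which this
assumption fails" (arXiv:1911.09446 §1).  PROOFS-g23 §5.11 LOCALISES the excluded case at `27 ∥ N`:
the points of `X₀(27M)_{𝔽̄₃}` (`3 ∤ M`) with a stabiliser of order divisible by `3` are exactly the
`2^{ω(M)−1}` images of the `ζ₃`-eigen `Γ₀(M)`-structures on the supersingular curve `j = 0` (they exist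
iff every prime `q ∣ M` is `≡ 1 (mod 3)`, since `ζ₃` has an eigenline in `E₀[q^e]` iff `q ≡ 1 (mod 3)`),
each with stabiliser exactly `ℤ/3` in `Aut(E₀)/±1 ≅ S₃`, and ALL of them, at ALL such levels, have
complete local ring isomorphic to ONE ring `𝔖₂₇ := (Def(E₀, C₂₇) ⊗̂ W(𝔽̄₃))^{μ₃}` (Katz–Mazur: the
coarse local ring is the stabiliser-invariants of the universal deformation ring of `(E₀, C₂₇)`, which
is regular of dimension 2 with special fibre `k⟦x,y⟧/((y − x²⁷)(y − x³)²(y³ − x)²(y²⁷ − x))` and does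
not see `C_M`).  Hence «`X₀(N)_{ℤ₍₃₎}` has rational singularities for ONE such `N`» ⟺ «for ALL» ⟺
«`p_g(𝔖₂₇) = 0`», a single wild `ℤ/3`-quotient singularity of a regular mixed-characteristic germ by a
geometric automorphism free off the closed point (no `ζ₃`-stable cyclic `27`-subgroup exists on the
CM curve: `ℤ[ζ₃]/(1−ζ₃)³` is not cyclic) — the class studied by Lorenzini (Math. Z. 2013; ANT 2014)
and Lorenzini–Schröer, where rationality is known only in ordinary/product situations.  The
`S₃`-quotient `𝔖₂₇/τ` (the singularity of `X₀(27)_{ℤ₃}` itself) IS rational: by Lipman's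
`R¹π_*ω = 0`, Grothendieck duality and Raynaud's cohomological flatness of the minimal desingularisation,
`Σ_x p_g(x) = ord₃ [H⁰(X₀(N)_{ℤ₃}, Ω) : Cot(𝒥₀(N)) ⊗ ℤ₃]` for every `N`, and at `N = 27` both lattices
are `ℤ₃ ω_f` (CNS `ω_f ∈ H⁰(X₀(N), Ω)`; `deg φ = 1` and Cremona's `c(27a1) = 1`); the same identity
gives rational singularities of `X₀(N)_ℤ` at every genus-zero level.

Typed here: **E-imc-185 `CNSBoundAtWildTwentySeven`** — the CNS inequality IN the excluded case at
`27 ∥ N` (a consequence of `p_g(𝔖₂₇) = 0` by CNS Thm. 1.2's last clause with `Γ' = Γ₀(N)`; census: of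
the 4287 isogeny classes with `27 ∥ N < 5·10⁵` and every other prime `≡ 1 (mod 3)`, the 4265 with Cremona
optimality code 1 have CERTIFIED optimal curve and `c = 1` (HOME/MANIN-ADDITIVE-CREMONA-TIER-v1.tsv.gz), the
other 22 (`N > 4·10⁵`, code `≥ 2`) are pending in the cell's engines; `3 ∣ deg φ` on 4264 of the 4265, so
the inequality never decides `3 ∤ c` there — the Manin-side residual of C3 on R1 stays with E-161/29.M), and
the PROVED
bookkeeping `padicVal_three_maninConstant_le_modularDegree_of_twentySeven` : printed fact ∧ E-imc-185 ⟹
the `p = 3` inequality at every level with `27 ∥ N`.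

PARTITION ladder-adjacent · beyond-print theorem: NO · BSD is not proved by this; Manin's conjecture is
not proved by this; C2/C3 OPEN.
-/

noncomputable section

namespace Summit.BirchSwinnertonDyer.Rank1Residual.ManinAdditive.WildTwentySeven

open Literature.NumberTheory.EllipticCurves.ModularForms

/-- crux-candidate **E-imc-185** (imc g23, MEMO-imc §29.9): the Česnavičius–Neururer–Saha inequality
`val₃(c_φ) ≤ val₃(deg φ)` in the case their Thm. 1.2 excludes, at `27 ∥ N`: every prime `q ∣ N` other
than `3` is `≡ 1 (mod 3)` (equivalently: no `q ∣ N` with `q ≡ 2 (mod 3)`; `N` is then odd).  Equivalent,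
given CNS Thm. 1.2's last clause, to the rationality of the single wild `ℤ/3`-quotient singularity `𝔖₂₇`
(PROOFS-g23 §5.11).  Why it might fail: `p_g(𝔖₂₇) > 0` is not excluded by anything in print (CNS: "not
one we know how to solve completely"); census: 4265/4265 certified classes `N < 5·10⁵` have `c = 1` (22
uncertified classes pending).
[cite: CesnaviciusNeururerSaha2023, Thm. 1.2 and §1 (rat-sing-main, reduce-to-compute)] -/
@[conjecture] def CNSBoundAtWildTwentySeven : Prop :=
  ∀ (W : WeierstrassCurve ℚ) [W.IsElliptic] [W.IsGloballyMinimal] [NeZero (W.conductorNorm ℤ)]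
    (D : ModularParametrizationData W (W.conductorNorm ℤ)),
    3 ^ 3 ∣ W.conductorNorm ℤ → ¬ 3 ^ 4 ∣ W.conductorNorm ℤ →
    (∀ q : ℕ, q.Prime → q ∣ W.conductorNorm ℤ → q % 3 ≠ 2) →
    padicValInt 3 D.maninConstant ≤ padicValNat 3 D.modularDegree

/-- PROVED bookkeeping: the printed CNS fact (tree rendering, exceptional clauses as hypotheses) together
with E-imc-185 gives the `p = 3` inequality `val₃(c_φ) ≤ val₃(deg φ)` for EVERY conductor-level datum at
every level with `27 ∥ N` (the case with a prime `q ≡ 2 (mod 3)` is the printed theorem, the complementary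
case is E-imc-185). -/
theorem padicVal_three_maninConstant_le_modularDegree_of_twentySeven
    (hCNS : cesnaviciusNeururerSaha_padicVal_maninConstant_le_modularDegree)
    (h185 : CNSBoundAtWildTwentySeven)
    (W : WeierstrassCurve ℚ) [W.IsElliptic] [W.IsGloballyMinimal] [NeZero (W.conductorNorm ℤ)]
    (D : ModularParametrizationData W (W.conductorNorm ℤ))
    (h27 : 3 ^ 3 ∣ W.conductorNorm ℤ) (h81 : ¬ 3 ^ 4 ∣ W.conductorNorm ℤ) :
    padicValInt 3 D.maninConstant ≤ padicValNat 3 D.modularDegree := by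
  by_cases hq : ∀ q : ℕ, q.Prime → q ∣ W.conductorNorm ℤ → q % 3 ≠ 2
  · exact h185 W D h27 h81 hq
  · exact hCNS W D 3 Nat.prime_three (fun h2 ↦ by omega) (fun h3 ↦ hq h3.2.2)

end Summit.BirchSwinnertonDyer.Rank1Residual.ManinAdditive.WildTwentySeven

end
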